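import Summits.QuantumFields.QCD.Theorems.PauliWegnerSeaChiralGluonicCompletionDefs
import Summits.QuantumFields.QCD.Theorems.PauliWegnerSeaGluonicCompletionDiagonal
import Literature.MathematicalPhysics.QuantumFieldTheory.QCDGoldstoneBound

/-!
# Crux `ChiralGluonicCompletion` (stmt-QuantumFields-17498), line `Sketch` (card strongly-chiral-subsequence) —
# the glue: heredity along Goldstone subsequences and the composition over the three registered stubs

The registered skeleton `Cruxes/ChiralGluonicCompletion/Lines/Sketch.lean` closes the crux as
`ChiralGluonicCompletion_of : stub_goldstone → stub_latticeGap → stub_continuum → crux`.  This file lands everything of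
it that is PROVED, over the landed packaged hypothesis (`PauliWegnerSeaChiralGluonicCompletionDefs.lean`: `Hyp`,
`PerMass`, `Body`, `ContinuumBody`):
* §2 heredity — `HasMassScaling`, asymptotic scaling, the lattice gap and the whole per-mass package `((i)∧(ii)∧(iii)∧(iv)) ∧ PQFD`
  pass to every subsequence `reg.restrict φ` (tail properties), and the full `Hyp` passes to every subsequence carrying
  the eventual Goldstone bound (`hyp_restrict`: the pin `IsChiralAtZero`, the one clause NOT inherited, is regained from
  `HasGoldstoneBound.isChiralAtZero`, Literature `QCDGoldstoneBound.lean`);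
* `body_of_parts` (continuum part + lattice gap ⟹ the
  `QCDOf` matrix with `Δ := min`, `latticeGap_anti`);
* §3 `chiralGluonicCompletion_of_stubs` — the composition, a CONDITIONAL theorem whose three hypotheses are verbatim the
  registered stubs (E) Goldstone bound along some subsequence, (C1) signed lattice gap at every `m > 0` at the given
  critical line, (C2) locally-`m`-uniform subsequential continuum half; one subsequence for all masses by the landed
  `CertifiedSeaThresholdGraft.stub_diagonal` (threshold `0`).  Worker verdicts 2026-08-17 (lead wave 1): C1
  `stub-blocked` on `DiagonalSpine.FullLatticeGap` (stmt-QuantumFields-8928), C2 `stub-blocked` on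
  `DiagonalSpine.LatticeToContinuum` (stmt-QuantumFields-8929); E ≈ `DiagonalSpine.ChiralTuning` (stmt-17436) for the
  given regularisation — the crux along any subsequencing line is DiagonalSpine's spine in same-regularisation form.
-/

noncomputable section

namespace Summit.QuantumFields.QCD.Theorems.StronglyChiralSubsequence

open MeasureTheory Filter Topology
open Literature.MathematicalPhysics.QuantumFieldTheory Literature.MathematicalPhysics.QuantumLattice
  Literature.Probability.LatticeModels

/-! ## §2 Heredity along subsequences (proved) -/

section Heredity

variable {Nf : ℕ} (reg : QCDRegularisation Nf) (φ : ℕ → ℕ) (hφ : StrictMono φ)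

/-- `HasMassScaling` passes to every subsequence (`Tendsto` composes with `φ → ∞`). -/
theorem hasMassScaling_restrict (h : reg.HasMassScaling) :
    (reg.restrict φ hφ.tendsto_atTop).HasMassScaling := by
  obtain ⟨c, hc, ht⟩ := h
  exact ⟨c, hc, ht.comp hφ.tendsto_atTop⟩

/-- Two-loop asymptotic scaling passes to every subsequence. -/
theorem hasAsymptoticScaling_restrict (h : (reg.scheme 0 0 0).HasAsymptoticScaling) :
    ((reg.restrict φ hφ.tendsto_atTop).scheme 0 0 0).HasAsymptoticScaling := by
  obtain ⟨Λ, hΛ, ht⟩ := h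
  exact ⟨Λ, hΛ, ht.comp hφ.tendsto_atTop⟩

/-- The uniform lattice gap at a mass tuple passes to every subsequence (it is an `∀ᶠ k` clause with `k`-uniform
constants). -/
theorem hasLatticeMassGap_restrict (m : Fin Nf → ℝ) {Δ : ℝ} (h : (reg.scheme m 0 0).HasLatticeMassGap Δ) :
    ((reg.restrict φ hφ.tendsto_atTop).scheme m 0 0).HasLatticeMassGap Δ := by
  intro R R' A B
  obtain ⟨C, hC⟩ := h R R' A B
  exact ⟨C, hφ.tendsto_atTop.eventually hC⟩

/-- The per-mass package `((i) ∧ (ii) ∧ (iii) ∧ (iv)) ∧ PQFD` passes to every subsequence: every clause is an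
`∀ᶠ k in atTop` statement with `k`-uniform constants, read through the `k`-th data `a_k, β_k, L_k, m_crit(k), Z_m(k)`. -/
theorem perMass_restrict (m : Fin Nf → ℝ) (h : PerMass Nf reg m) :
    PerMass Nf (reg.restrict φ hφ.tendsto_atTop) m := by
  obtain ⟨⟨h1, h2, h3, h4⟩, h5⟩ := h
  refine ⟨⟨fun f => hφ.tendsto_atTop.eventually (h1 f), ?_, ?_, hφ.tendsto_atTop.eventually h4⟩, ?_⟩
  · obtain ⟨s, δ, C, hs, hs1, hδ, hev⟩ := h2
    exact ⟨s, δ, C, hs, hs1, hδ, hφ.tendsto_atTop.eventually hev⟩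
  · obtain ⟨s, c₀, C₁, p, hs, hs1, hc₀, hev⟩ := h3
    exact ⟨s, c₀, C₁, p, hs, hs1, hc₀, hφ.tendsto_atTop.eventually hev⟩
  · obtain ⟨δ', hδ', hAB⟩ := h5
    refine ⟨δ', hδ', fun R R' A B hA => ?_⟩
    obtain ⟨C', hev⟩ := hAB R R' A B hA
    exact ⟨C', hφ.tendsto_atTop.eventually hev⟩

/-- **The whole package is hereditary along every subsequence that carries the Goldstone bound**: mass scaling,
asymptotic scaling and the per-mass clauses are tail properties, and the pin `IsChiralAtZero` of the subsequence —
the one clause that is NOT inherited — is regained from the bound (`HasGoldstoneBound.isChiralAtZero`). -/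
theorem hyp_restrict (h : Hyp Nf reg) (hG : (reg.restrict φ hφ.tendsto_atTop).HasGoldstoneBound) :
    Hyp Nf (reg.restrict φ hφ.tendsto_atTop) :=
  ⟨hasMassScaling_restrict reg φ hφ h.1, hG.isChiralAtZero, hasAsymptoticScaling_restrict reg φ hφ h.2.2.1,
    fun m hm => perMass_restrict reg φ hφ m (h.2.2.2 m hm)⟩

end Heredity

/-- The uniform lattice mass gap is antitone in the rate: a gap `Δ` is a gap `Δ' ≤ Δ` (same argument as
`ChiralDescent.Negative.hasLatticeMassGap_mono`, reproved here to keep this file's imports inside the line). -/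
theorem latticeGap_anti {Nf : ℕ} (sch : QCDScheme Nf) {Δ Δ' : ℝ} (hle : Δ' ≤ Δ)
    (h : sch.HasLatticeMassGap Δ) : sch.HasLatticeMassGap Δ' := by
  intro R R' A B
  obtain ⟨C, hC⟩ := h R R' A B
  refine ⟨max C 0, ?_⟩
  filter_upwards [hC] with k hk S hS n hn
  refine (hk S hS n hn).trans ?_
  have ha : 0 ≤ sch.a k * n := mul_nonneg (sch.a_pos k).le (Nat.cast_nonneg n)
  calc C * Real.exp (-(Δ * (sch.a k * n)))
      ≤ max C 0 * Real.exp (-(Δ * (sch.a k * n))) :=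
        mul_le_mul_of_nonneg_right (le_max_left _ _) (Real.exp_pos _).le
    _ ≤ max C 0 * Real.exp (-(Δ' * (sch.a k * n))) :=
        mul_le_mul_of_nonneg_left (Real.exp_le_exp.mpr (by nlinarith)) (le_max_right _ _)

/-- The matrix of `QCDOf` at `m` from its two halves: the continuum part and a lattice gap at `m`, with the common
rate `Δ := min Δ_cont Δ_lat` (both gap clauses are antitone in the rate — for the OS gap the five-line argument of the landed
`LocalAcOpenCertificate.osMassGap_anti` is inlined to keep the imports inside the line; the lattice clause does not read the
species renormalisations `z, shift`). -/
theorem body_of_parts {Nf : ℕ} (reg : QCDRegularisation Nf) (m : Fin Nf → ℝ) (hc : ContinuumBody Nf reg m)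
    (hl : ∃ Δ > 0, (reg.scheme m 0 0).HasLatticeMassGap Δ) : Body Nf reg m := by
  obtain ⟨z, shift, T, hQ, hN, hG, hP, Δ₁, hΔ₁, hT⟩ := hc
  obtain ⟨Δ₂, hΔ₂, hL⟩ := hl
  refine ⟨z, shift, T, hQ, hN, hG, hP, min Δ₁ Δ₂, lt_min hΔ₁ hΔ₂, ?_,
    latticeGap_anti (reg.scheme m 0 0) (min_le_right _ _) hL⟩
  -- the OS gap is antitone in the rate (`t ≥ 0`; constant `max C 0`)
  intro n n' k k' F G' hF hG
  obtain ⟨C, hC⟩ := hT n n' k k' F G' hF hG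
  refine ⟨max C 0, fun t ht H hH => (hC t ht H hH).trans ?_⟩
  have hle : min Δ₁ Δ₂ ≤ Δ₁ := min_le_left _ _
  calc C * Real.exp (-Δ₁ * t) ≤ max C 0 * Real.exp (-Δ₁ * t) :=
        mul_le_mul_of_nonneg_right (le_max_left _ _) (Real.exp_pos _).le
    _ ≤ max C 0 * Real.exp (-min Δ₁ Δ₂ * t) :=
        mul_le_mul_of_nonneg_left (Real.exp_le_exp.2 (by nlinarith)) (le_max_right _ _)

/-! ## §3 Composition -/

/-- **The composition of the line** (pure bookkeeping over the three stubs taken as hypotheses).  Given `N_f ∈ {2,3}`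
and `reg` with the package: (E) pick the Goldstone subsequence `reg₀ := reg.restrict φ₀`; the package passes to it
(`hyp_restrict`).  Around every positive `m₀`, (C2) gives a box and, from every further subsequence, an extraction
carrying the continuum matrix on the box; the package — Goldstone bound included — passes to that extraction, so (C1)
gives the lattice gap there, and `body_of_parts` the full matrix.  The LANDED diagonal lemma
`CertifiedSeaThresholdGraft.stub_diagonal` (threshold `0`) turns this into ONE subsequence `reg₀.restrict φ` carrying
the matrix for every positive tuple; `HasMassScaling` rides along and the Goldstone bound gives `IsChiralAtZero` of the
final regularisation — the witness of `QCDOf N_f`. -/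
theorem chiralGluonicCompletion_of_stubs : (∀ Nf : ℕ, Nf = 2 ∨ Nf = 3 → ∀ reg : QCDRegularisation Nf, Hyp Nf reg → ∃ φ : ℕ → ℕ, ∃ hφ : StrictMono φ, (reg.restrict φ hφ.tendsto_atTop).HasGoldstoneBound) → (∀ Nf : ℕ, Nf = 2 ∨ Nf = 3 → ∀ reg : QCDRegularisation Nf, Hyp Nf reg → ∀ m : Fin Nf → ℝ, (∀ f, 0 < m f) → ∃ Δ > 0, (reg.scheme m 0 0).HasLatticeMassGap Δ) → (∀ Nf : ℕ, Nf = 2 ∨ Nf = 3 → ∀ reg : QCDRegularisation Nf, Hyp Nf reg → ∀ m₀ : Fin Nf → ℝ, (∀ f, 0 < m₀ f) → ∃ ε : ℝ, 0 < ε ∧ ∀ (ψ : ℕ → ℕ) (hψ : StrictMono ψ), ∃ (φ : ℕ → ℕ) (hφ : StrictMono φ), ∀ m : Fin Nf → ℝ, (∀ f, 0 < m f) → (∀ f, |m f - m₀ f| < ε) → ContinuumBody Nf (reg.restrict (ψ ∘ φ) (hψ.comp hφ).tendsto_atTop) m) → Summit.QuantumFields.QCD.Theses.PauliWegnerSea.ChiralGluonicCompletion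 := by
  intro hE hC1 hC2 Nf hNf hex
  obtain ⟨reg, hH⟩ := hex
  -- (E) the Goldstone subsequence; the package passes to it
  obtain ⟨φ₀, hφ₀, hG₀⟩ := hE Nf hNf reg hH
  have hH₀ : Hyp Nf (reg.restrict φ₀ hφ₀.tendsto_atTop) := hyp_restrict reg φ₀ hφ₀ hH hG₀
  -- one subsequence for all positive mass tuples (threshold `0`)
  obtain ⟨φ, hφ, hall⟩ := CertifiedSeaThresholdGraft.stub_diagonal Nf (reg.restrict φ₀ hφ₀.tendsto_atTop) 0
    (fun m₀ hm₀ => by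
      obtain ⟨ε, hε, hext⟩ := hC2 Nf hNf _ hH₀ m₀ hm₀
      refine ⟨ε, hε, fun ψ hψ => ?_⟩
      obtain ⟨φ, hφ, hbox⟩ := hext ψ hψ
      refine ⟨φ, hφ, fun m hm hmbox => ?_⟩
      have hHψφ : Hyp Nf ((reg.restrict φ₀ hφ₀.tendsto_atTop).restrict (ψ ∘ φ) (hψ.comp hφ).tendsto_atTop) :=
        hyp_restrict _ (ψ ∘ φ) (hψ.comp hφ) hH₀ (hG₀.restrict _ _)
      exact body_of_parts _ m (hbox m hm hmbox) (hC1 Nf hNf _ hHψφ m hm))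
  unfold QCDOf
  exact ⟨(reg.restrict φ₀ hφ₀.tendsto_atTop).restrict φ hφ.tendsto_atTop,
    hasMassScaling_restrict _ φ hφ hH₀.1, (hG₀.restrict φ hφ.tendsto_atTop).isChiralAtZero,
    fun m hm => hall m hm⟩

end Summit.QuantumFields.QCD.Theorems.StronglyChiralSubsequence

end
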